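/-
Copyright (c) 2026 the pub-hodgecm-mathlib formalisation cell (harness21).  Prover seat hodgecm-mathlib-A-p19 (g27), 2026-09-02.  Road «S3-tree»∕«S3-ram» (LEAD F0P3a-plan (g12)
T11-41∕T11-52; owner p06 (g15)), row «R2²-ram», organ «THE NORM CLASS READING AT A TAME-RAMIFIED PLACE» — the residue reading of «`X` is a `σ_w`-norm» for a `σ_w`-fixed `X ≠ 0`,
the form in which the (α₂) G-side sums the law ★ `RationalGoodVectorRamifiedPlaceEigenData.exists_rational_norm_law_iff_of_eigenData` over classes.
-/
import Literature.NumberTheory.LocalFields.RamifiedPlaceNormDictionary   -- ★ p847338 part D (this seat): (U1) in valuation currency, even order of fixed elements; brings ★ anti-fixed uniformiser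
import HarnessLib

/-!
# The norm class reading at a tamely ramified quadratic place: `X ∈ N(E_w^×)` iff the unit `X·(ϖσ_wϖ)^{−k}` is residually a square (Serre V §3 Cor. 2)

Topic `NumberTheory/LocalFields`; namespace `Literature.NumberTheory.LocalFields.RamifiedPlaceNormDictionary`.  THEOREMS ONLY (no definition, no instance, no notation, no named
fact, no `sorry`); kernel lane `--supports stmt-HodgeConjecture-24833`.  Cell `pub/hodgecm-mathlib` (D-0151), crux H413; road «S3-tree», seeding wave «S3-ram», row «R2²-ram»; organ
**«THE NORM CLASS READING»** (this seat).  Frame of ★ `RamifiedPlaceNormDictionary`: `E ∕ F` quadratic number fields, `c ≠ 1`, `w ∣ v` with `c • w = w`, RAMIFIED and TAME,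
`σ := galAdicCompletionMap c hw`, `ϖ` an anti-fixed uniformiser (`|ϖ| = exp(−1)`, `σϖ = −ϖ`, ★ `exists_uniformizer_galAdicCompletionMap_eq_neg_of_ramified`).

* **`exists_mul_galAdicCompletionMap_mul_eq_one_iff_of_valued_eq_one_of_ramified`** (units): for a `σ`-fixed `X` with `|X| = 1`,
  `(∃ z, z·σz·X = 1) ↔ ∃ r ∈ 𝒪, |X − r²| < 1`.
* **`exists_mul_galAdicCompletionMap_mul_eq_one_iff_of_ramified`** (general): for a `σ`-fixed `X ≠ 0` with `|X| = |ϖ|^{2k}` (★ `exists_valued_eq_zpow_two_mul_of_galAdicCompletionMap_eq_of_ramified`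
  always supplies such a `k`), `(∃ z, z·σz·X = 1) ↔ ∃ r ∈ 𝒪, |X·(ϖ·σϖ)^{−k} − r²| < 1` — «`X` is a norm from `E_w` iff the unit part of `X` relative to the NORM `ϖσϖ = −ϖ²` of order `2` is
  residually a square»; the Legendre-symbol reading of the law's right side `∃ z : L_w, z·σ_w z·(d₀·det J·χ_λ(u)∕((1+u)²χ_λ(−1))) = 1` (★ `exists_rational_norm_law_iff_of_eigenData`).
  HONEST LABEL: HC_CM is proved only modulo the 2 remaining named inputs (hLiu418 24832, h413 24833) until rung 0 closes; local algebra, count-neutral.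

## References
* [SerreLocalFields1979] J.-P. Serre, *Local Fields*, GTM 67 (1979): Ch. V §3 Prop. 5 and Cor. 2; Ch. XIV §4.
* [Neukirch1999] J. Neukirch, *Algebraic Number Theory*, Grundlehren 322 (1999): Ch. V (1.2).
-/

set_option autoImplicit false

noncomputable section

open NumberField IsDedekindDomain ValuativeRel
open scoped ValuativeRel
open Literature.NumberTheory.Automorphic Literature.NumberTheory.Automorphic.UnitaryGroup
open Literature.NumberTheory.LocalFields.RamifiedPlaceUnitNorms

namespace Literature.NumberTheory.LocalFields.RamifiedPlaceNormDictionary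

variable {F : Type} (E : Type) [Field F] [NumberField F] [Field E] [NumberField E] [Algebra F E] [Algebra.IsQuadraticExtension F E]
  (c : E ≃ₐ[F] E) (hc : c ≠ 1) (v : HeightOneSpectrum (𝓞 F)) (w : PlacesOver E v) (hw : c • w.1 = w.1)

include hc in
/-- **THE NORM CLASS READING FOR UNITS**: a `σ_w`-fixed `X` with `|X|_w = 1` satisfies `(∃ z, z·σ_w z·X = 1) ↔ ∃ r ∈ 𝒪[E_w], |X − r²|_w < 1` (★ (U1) in valuation currency, for
`X⁻¹ = X·X⁻²`, `X⁻² = N(X⁻¹)`). [cite: SerreLocalFields1979, Ch. V §3 Prop. 5, Cor. 2] -/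
theorem exists_mul_galAdicCompletionMap_mul_eq_one_iff_of_valued_eq_one_of_ramified (he : v.asIdeal.ramificationIdx' w.1.asIdeal ≠ 1)
    (h2 : Valued.v (2 : w.1.adicCompletion E) = 1) {X : w.1.adicCompletion E} (hX1 : Valued.v X = 1)
    (hσX : galAdicCompletionMap (L := E) c hw X = X) :
    (∃ z : w.1.adicCompletion E, z * galAdicCompletionMap (L := E) c hw z * X = 1) ↔
      ∃ r : w.1.adicCompletion E, Valued.v r ≤ 1 ∧ Valued.v (X - r ^ 2) < 1 := by
  have hX0 : X ≠ 0 := fun h => by rw [h, map_zero] at hX1; exact zero_ne_one hX1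
  have hσσ : ∀ y, galAdicCompletionMap (L := E) c hw (galAdicCompletionMap (L := E) c hw y) = y := fun y =>
    galAdicCompletionMap_galAdicCompletionMap_of_smul_eq c w hc hw y
  rw [← exists_mul_galAdicCompletionMap_eq_iff_exists_valued_sub_sq_lt_one_of_ramified E c hc v w hw he h2 hX1 hσX]
  constructor
  · rintro ⟨z, hz⟩
    refine ⟨galAdicCompletionMap (L := E) c hw z * X, ?_⟩
    rw [map_mul, hσσ, hσX]
    linear_combination X * hz
  · rintro ⟨z, hz⟩
    have hz0 : z ≠ 0 := by rintro rfl; rw [zero_mul] at hz; exact hX0 hz.symm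
    have hσz0 : galAdicCompletionMap (L := E) c hw z ≠ 0 := fun h => hX0 (by rw [← hz, h, mul_zero])
    refine ⟨z⁻¹, ?_⟩
    rw [map_inv₀, ← hz]
    field_simp

include hc in
/-- **THE NORM CLASS READING**: for a `σ_w`-fixed `X ≠ 0` with `|X|_w = |ϖ|_w^{2k}` (`ϖ` anti-fixed of order one), `(∃ z, z·σ_w z·X = 1) ↔ ∃ r ∈ 𝒪[E_w], |X·(ϖ·σ_wϖ)^{−k} − r²|_w < 1`:
`(ϖσ_wϖ)^{−k} = N(ϖ^{−k})` is a norm and `g := X·(ϖσ_wϖ)^{−k}` is a fixed UNIT, read by the unit case. [cite: SerreLocalFields1979, Ch. V §3 Cor. 2; Ch. XIV §4] [cite: Neukirch1999, Ch. V (1.2)] -/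
theorem exists_mul_galAdicCompletionMap_mul_eq_one_iff_of_ramified (he : v.asIdeal.ramificationIdx' w.1.asIdeal ≠ 1)
    (h2 : Valued.v (2 : w.1.adicCompletion E) = 1) {ϖ : w.1.adicCompletion E} (hϖ : Valued.v ϖ = WithZero.exp (-1 : ℤ))
    (hσϖ : galAdicCompletionMap (L := E) c hw ϖ = -ϖ) {X : w.1.adicCompletion E} (hσX : galAdicCompletionMap (L := E) c hw X = X)
    {k : ℤ} (hk : Valued.v X = Valued.v ϖ ^ (2 * k)) :
    (∃ z : w.1.adicCompletion E, z * galAdicCompletionMap (L := E) c hw z * X = 1) ↔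
      ∃ r : w.1.adicCompletion E, Valued.v r ≤ 1 ∧ Valued.v (X * (ϖ * galAdicCompletionMap (L := E) c hw ϖ) ^ (-k) - r ^ 2) < 1 := by
  have hσσ : ∀ y, galAdicCompletionMap (L := E) c hw (galAdicCompletionMap (L := E) c hw y) = y := fun y =>
    galAdicCompletionMap_galAdicCompletionMap_of_smul_eq c w hc hw y
  have hϖ0 : ϖ ≠ 0 := fun h => by rw [h, map_zero] at hϖ; exact WithZero.zero_ne_coe hϖ
  -- the fixed norm `ν := ϖ·σϖ` of order two and the fixed unit `g := X·ν^{−k}`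
  obtain ⟨ν, hν⟩ : ∃ ν : w.1.adicCompletion E, ν = ϖ * galAdicCompletionMap (L := E) c hw ϖ := ⟨_, rfl⟩
  have hν0 : ν ≠ 0 := by rw [hν, hσϖ]; exact mul_ne_zero hϖ0 (neg_ne_zero.2 hϖ0)
  have hσν : galAdicCompletionMap (L := E) c hw ν = ν := by rw [hν, map_mul, hσσ, mul_comm]
  have hvν : Valued.v ν = WithZero.exp (-2 : ℤ) := by
    rw [hν, hσϖ, mul_neg, Valuation.map_neg, map_mul, hϖ, ← WithZero.exp_add]; norm_num
  have hνk : ν ^ (-k) = ϖ ^ (-k) * galAdicCompletionMap (L := E) c hw (ϖ ^ (-k)) := by rw [hν, mul_zpow, map_zpow₀]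
  have hg1 : Valued.v (X * ν ^ (-k)) = 1 := by
    rw [map_mul, map_zpow₀, hk, hϖ, hvν, ← WithZero.exp_zsmul, ← WithZero.exp_zsmul, ← WithZero.exp_add, ← WithZero.exp_zero]
    congr 1; simp only [smul_eq_mul]; ring
  have hσg : galAdicCompletionMap (L := E) c hw (X * ν ^ (-k)) = X * ν ^ (-k) := by rw [map_mul, map_zpow₀, hσX, hσν]
  rw [← hν, ← exists_mul_galAdicCompletionMap_mul_eq_one_iff_of_valued_eq_one_of_ramified E c hc v w hw he h2 hg1 hσg]
  have hϖk0 : ϖ ^ (-k) ≠ 0 := zpow_ne_zero _ hϖ0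
  have hσϖk0 : galAdicCompletionMap (L := E) c hw (ϖ ^ (-k)) ≠ 0 := fun h => hϖk0 (by rw [← hσσ (ϖ ^ (-k)), h, map_zero])
  constructor
  · rintro ⟨z, hz⟩
    refine ⟨z * (ϖ ^ (-k))⁻¹, ?_⟩
    rw [hνk, map_mul, map_inv₀]
    have hre : z * (ϖ ^ (-k))⁻¹ * (galAdicCompletionMap (L := E) c hw z * (galAdicCompletionMap (L := E) c hw (ϖ ^ (-k)))⁻¹) *
        (X * (ϖ ^ (-k) * galAdicCompletionMap (L := E) c hw (ϖ ^ (-k)))) =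
        z * galAdicCompletionMap (L := E) c hw z * X * ((ϖ ^ (-k))⁻¹ * ϖ ^ (-k)) *
          ((galAdicCompletionMap (L := E) c hw (ϖ ^ (-k)))⁻¹ * galAdicCompletionMap (L := E) c hw (ϖ ^ (-k))) := by ring
    rw [hre, inv_mul_cancel₀ hϖk0, inv_mul_cancel₀ hσϖk0, mul_one, mul_one]
    exact hz
  · rintro ⟨z, hz⟩
    refine ⟨z * ϖ ^ (-k), ?_⟩
    rw [map_mul]
    rw [hνk] at hz
    linear_combination hz

end Literature.NumberTheory.LocalFields.RamifiedPlaceNormDictionary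

end
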